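import Summits.QuantumFields.BalabanUV.T4Continuum.Support.CovariantVectorGreenDecayChartExplicit
import Summits.QuantumFields.BalabanUV.T4Continuum.Support.SubstrateCovarianceChartBound

/-!
# T⁴ programme, SUBSTRATE (shared lattice-gauge analysis library) — ENTRY DECAY OF THE COVARIANCE SPECIES ON THE COMPLEX CHART BALL: the
# unit-lattice covariance `C(R′, S′) = s·Q(R′)·G(R′, S′)·Qᴬ(S′)` (`SubstrateTransporterSpecies.unitCovT`, the species NE5 ∕ NE9 read through
# `covAtT(Lev)`) at `R′ = e^{A}R⁰`, `S′ = (R⁰)⁻¹e^{−A}` inherits the Green's function's Combes–Thomas decay: for coarse bonds `b, b′` whose block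
# stencils are at fine sup-distance `≥ n·r`, `‖C(b, b′)‖ ≤ ‖s‖·(3 + E)²·|o|·n^{−d}·(8∕γ)·e^{−κ_F·r}`, and on the level-`k` cylinder of radius
# `rhoStar∕lev k` the LEVEL SHAPE `‖C_k(b, b′)‖ ≤ ‖s‖·16·|o|·(lev k)^{−d}·(8∕γ)·e^{−κ_F·r}` — rate `κ_F` and separation `r` level-free
# (typer LIBRARY L-A9 = W-9b; rulings (λ12) journal l.17637, (λ15) l.17798)

Substrate cell `b2b-balaban-substrate-*`, seat p3 (gens 2–3).  A Schur composition, nothing new analytically: the entry `C(b, b′)` is the pairing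
`s·⟨u, G v⟩` with `u` = the `b`-row of `Q(R′)` (supported on the block stencil of `b`, entries `≤ (3 + E)·qr`) and `v` = the `b′`-column of
`Qᴬ(S′)` (stencil of `b′`, entries `≤ (3 + E)·qr`) — file 2's `chart_entry_majorants`; file 3's `greenT_chart_setDecay` with the source `T :=`
the stencil sites of `b′` then gives the decay, and `‖u‖², ‖v‖² ≤ (3 + E)²·|o|·n^{−d}` (`Σ qr² ≤ n^{−d}·Σ qr`, `DeltaACombesThomas.sum_qr_row ∕ sum_qr_col`).
 * §1 `unitCovT_apply_eq_pairing` (the entry as a pairing), `nsq_le_of_qr_majorant` (`‖X i‖ ≤ ε·qr(b, i₁) ⇒ nsq X ≤ ε²·|o|·n^{−d}`),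
   `qr_stencil_pos` (the stencil point `(bpt y 0 + 0·e_μ, μ)` has `qr > 0`);
 * §2 **`unitCovT_chart_setDecay`** (any admissible rate: `JchT κ < γ∕4`), **`unitCovT_chart_entry_decay_explicit`** (`κ = kappaF`, amplitude
   `‖s‖·(3 + E)²·|o|·n^{−d}·8∕γ`, `E = Etr (‖A‖e^{‖A‖}) ℓ ≤ 2` inside `rho1` left symbolic), for `‖A‖ < rho1` — the hypothesis
   `hr : qr(b, i) ≠ 0 → qr(b′, i′) ≠ 0 → n·r ≤ ldist i₁ i′₁` is the honest geometric input (stencil separation in fine units; a consumer converts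
   coarse block distance into `r`);
 * §3 the level-`k` CYLINDER form **`unitCovT_chart_entry_decay_level`** (`‖A k‖ < rhoStar∕lev k` = p1's `levelBall` unfolded; printed letters
   `(lev k, a′(lev k)^d)` = `cPr`∕`aPr` by `rfl`) and the tower-ball form **`unitCovT_chart_entry_decay_tower`** on `InHoloBallT P R⁰ (rhoStar∕lev k)`;
 * §4 the LEVEL SHAPE (ruling (λ15)): on the cylinder `levelBall P k (rhoStar∕lev k)` (p224945) the scaling smallness
   `SubstrateCovarianceChartBound.ell_mul_delta_le_half` + `Etr_le_one` (p227479, cited BY NAME) give `E ≤ 1`, so `(3 + E)² ≤ 16`: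
   **`unitCovT_chart_entry_decay_levelBall`** (`‖C_k(b, b′)‖ ≤ ‖s‖·(16·|o|·((lev k)^d)⁻¹)·(8∕γ)·e^{−κ_F·r}` at the printed letters `cPr P k`,
   `aPr P a′ k`), **`unitCovT_chart_entry_decay_tower_levelShape`** (the same on `InHoloBallT P R⁰ (rhoStar∕lev k)`),
   **`unitCovT_chart_entry_decay_tower_levelFree`** (`(lev k)^{−d} ≤ 1` dropped: `‖s‖·(16·|o|)·(8∕γ)·e^{−κ_F·r}` — for ONE weight `s`; for a weight
   SEQUENCE the only level-indexed letter left is `‖s k‖`, cf. W-15's `covBound_le_levelFree`), and the `covAtTLev` ENTRY FACE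
   **`norm_covAtTLev_chart_entry_decay_on_levelBall`** (weights `s : ℕ → ℂ`, tag `t`, level `k ≤ K` — W-15's `norm_covAtTLev_le_on_levelBall` with
   decay; the two files instantiate with one `fun`-block).  LEVEL-UNIFORMITY MADE VISIBLE: the rate `kappaF |o| d a′ γ` and the separation `r`
   (coarse units) do not see `k`; the amplitude sees `k` only through `‖s k‖·(lev k)^{−d} ≤ ‖s k‖`.
 * NOT HERE (sized > 40 l., (λ12)(ii)): the conversion of a coarse block distance into the displayed stencil separation `hr` (`hr_of_blockDist`,
   via `Beta.EffectiveKernel.circAbs_scale`) — follower module W-9c.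
HONEST FRAMING (T4-DAG p. 1).  MODEL-level finite-dimensional linear algebra ([folklore]; constants OURS and crude); a structural lemma of the
substrate's own chart objects, NOT an estimate of any NE row; nothing printed is a hypothesis ([Balaban1988RG2Cluster] (1.5) p. 3 is a KIND
pointer only); the by-name junction with a row's covariance letter (NE2's `pertCovC`, NE5's `rawTOfRecord.gc`) is the ROW's, not claimed; no `def`;
spine 0/9 unchanged; NOT infinite volume ∕ mass gap ∕ Clay.  HONEST DEPENDENCY: continuum YM on T⁴ ⇐ BetaPertH ∧ nine spine estimates (0/9 proved);
BetaPertH ⇐ (D1) ∧ (D4) ∧ CAP+tail; G-an2-4 gates asym, D1 and NE2/3/4.  ABSOLUTE RULE kept; no `sorry`.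
-/

noncomputable section

open scoped BigOperators ComplexConjugate Matrix Matrix.Norms.L2Operator Kronecker ComplexOrder

namespace Summit.QuantumFields.BalabanUV.T4Continuum.CovariantVectorCovarianceDecayChart

open Literature.MathematicalPhysics.QuantumFieldTheory.Balaban1983to89.B5Prop11Plancherel (Tor fine)
open Literature.MathematicalPhysics.QuantumFieldTheory.Balaban1983to89.B5Prop11Lower (nsq nsq_nonneg)
open Literature.MathematicalPhysics.QuantumFieldTheory.Balaban1983to89.B5Block118 (bpt tstep)
open Literature.MathematicalPhysics.QuantumFieldTheory.Balaban1983to89.Beta.DeltaACombesThomas (qr qr_nonneg qr_ne_zero sum_qr_row sum_qr_col)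
open Literature.MathematicalPhysics.QuantumFieldTheory.Balaban1983to89.Beta.TorusG0Decay (ldist)
open Summit.QuantumFields.BalabanUV.T4Continuum
open Summit.QuantumFields.BalabanUV.T4Continuum.CovariantBlockAveraging (ContourSystem Qcov)
open Summit.QuantumFields.BalabanUV.T4Continuum.CoerciveInverseTower (Coercive)
open Summit.QuantumFields.BalabanUV.T4Continuum.SubstrateTransporterSpecies
open Summit.QuantumFields.BalabanUV.T4Continuum.CovariantVectorCoercive (vecOp)
open Summit.QuantumFields.BalabanUV.T4Continuum.CovariantVectorCoerciveHolo (InHoloBallT inHoloBallT_apply)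
open Summit.QuantumFields.BalabanUV.T4Continuum.CovariantVectorChartFactorisation (Etr Etr_nonneg)
open Summit.QuantumFields.BalabanUV.T4Continuum.CovariantVectorCoerciveHoloForm (rho1 rhoStar rhoStar_div_le_rho1)
open Summit.QuantumFields.BalabanUV.T4Continuum.CovariantVectorChartConjugationAvg (chart_entry_majorants)
open Summit.QuantumFields.BalabanUV.T4Continuum.CovariantVectorGreenDecayChart (JchT greenT_chart_setDecay)
open Summit.QuantumFields.BalabanUV.T4Continuum.CovariantVectorGreenDecayChartExplicit (kappaF kappaF_pos_le_one Jch_kappaF_le)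

variable {d : ℕ} {o : Type*} [Fintype o] [DecidableEq o] [Nonempty o]

/-! ## §1 The covariance entry as a pairing; norms on the `qr` pattern -/

section Pairing

variable (n : ℕ) [NeZero n] (M : Fin d → ℕ) [hM : ∀ μ, NeZero (M μ)]

omit [Nonempty o] in
/-- **THE ENTRY AS A PAIRING**: `C(R, S)(b, b′) = s·⟨u, G v⟩` with `u i = (Q(R) b i)⋆`, `v j = Qᴬ(S) j b′`. [folklore] -/
theorem unitCovT_apply_eq_pairing (c : ℂ) (a : ℝ) (s : ℂ) (Γ : ContourSystem d n M) (R S : Fin d → (Tor (fine n M) × Fin d → Matrix o o ℂ))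
    (b b' : (Tor M × Fin d) × o) :
    unitCovT n M c a s Γ R S b b'
      = s * (star (fun i => star (Qcov n M Γ R b i)) ⬝ᵥ (greenT n M c a Γ R S *ᵥ fun j => QcovA n M Γ S j b')) := by
  rw [unitCovT, Matrix.smul_apply, smul_eq_mul, Matrix.mul_apply]
  congr 1
  simp only [dotProduct, Matrix.mulVec, Pi.star_apply, star_star, Matrix.mul_apply, Finset.sum_mul, Finset.mul_sum]
  rw [Finset.sum_comm]
  refine Finset.sum_congr rfl fun i _ => Finset.sum_congr rfl fun j _ => ?_
  ring

omit [DecidableEq o] [Nonempty o] in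
/-- `Σ_i qr(b, i₁)² ≤ |o|·n^{−d}` and hence **`‖X i‖ ≤ ε·qr(b, i₁) ⇒ nsq X ≤ ε²·|o|·n^{−d}`**. [folklore] -/
theorem nsq_le_of_qr_majorant (b : Tor M × Fin d) (X : (Tor (fine n M) × Fin d) × o → ℂ) {ε : ℝ}
    (hX : ∀ i, ‖X i‖ ≤ ε * qr n M b i.1) : nsq X ≤ ε ^ 2 * Fintype.card o * ((n : ℝ) ^ d)⁻¹ := by
  have hn : (0 : ℝ) < (n : ℝ) ^ d := pow_pos (by exact_mod_cast Nat.pos_of_ne_zero (NeZero.ne n)) d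
  -- one entry of `qr` is at most the column sum `n^{−d}`
  have hqr1 : ∀ i : Tor (fine n M) × Fin d, qr n M b i ≤ ((n : ℝ) ^ d)⁻¹ := fun i => by
    rw [← one_div, ← sum_qr_col n M i]
    exact Finset.single_le_sum (f := fun b'' => qr n M b'' i) (fun b'' _ => qr_nonneg n M b'' i) (Finset.mem_univ b)
  calc nsq X = ∑ i, ‖X i‖ ^ 2 := rfl
    _ ≤ ∑ i : (Tor (fine n M) × Fin d) × o, ε ^ 2 * (((n : ℝ) ^ d)⁻¹ * qr n M b i.1) := by
        refine Finset.sum_le_sum fun i _ => ?_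
        have h1 : ‖X i‖ ^ 2 ≤ (ε * qr n M b i.1) ^ 2 := pow_le_pow_left₀ (norm_nonneg _) (hX i) 2
        have h2 : (ε * qr n M b i.1) ^ 2 = ε ^ 2 * (qr n M b i.1 * qr n M b i.1) := by ring
        have h3 : qr n M b i.1 * qr n M b i.1 ≤ ((n : ℝ) ^ d)⁻¹ * qr n M b i.1 :=
          mul_le_mul_of_nonneg_right (hqr1 i.1) (qr_nonneg n M b i.1)
        nlinarith [sq_nonneg ε]
    _ = ε ^ 2 * Fintype.card o * ((n : ℝ) ^ d)⁻¹ := by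
        rw [← Finset.mul_sum, ← Finset.mul_sum, Fintype.sum_prod_type, Finset.sum_comm]
        simp only [Finset.sum_const, Finset.card_univ, nsmul_eq_mul]
        rw [sum_qr_row]; ring

omit [Fintype o] [DecidableEq o] [Nonempty o] hM in
/-- the base stencil point `(bpt y 0 + tstep μ 0, μ)` of the coarse bond `(y, μ)` carries `qr > 0`. [folklore] -/
theorem qr_stencil_pos (b : Tor M × Fin d) : 0 < qr n M b (bpt n M b.1 (fun _ => 0) + tstep (fine n M) b.2 ((0 : Fin n) : ℕ), b.2) := by
  have hn : (0 : ℝ) < 1 / (n : ℝ) ^ (d + 1) := by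
    have : (0 : ℝ) < (n : ℝ) ^ (d + 1) := pow_pos (by exact_mod_cast Nat.pos_of_ne_zero (NeZero.ne n)) _
    positivity
  rw [qr]
  refine lt_of_lt_of_le hn ?_
  have h1 : (1 : ℝ) / (n : ℝ) ^ (d + 1)
      ≤ ∑ t : Fin n, (if (bpt n M b.1 (fun _ => 0) + tstep (fine n M) b.2 ((0 : Fin n) : ℕ), b.2) = (bpt n M b.1 (fun _ => 0) + tstep (fine n M) b.2 t, b.2)
          then 1 / (n : ℝ) ^ (d + 1) else 0) := by
    refine (Finset.single_le_sum (f := fun t : Fin n => if (bpt n M b.1 (fun _ => 0) + tstep (fine n M) b.2 ((0 : Fin n) : ℕ), b.2)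
        = (bpt n M b.1 (fun _ => 0) + tstep (fine n M) b.2 t, b.2) then 1 / (n : ℝ) ^ (d + 1) else (0 : ℝ))
        (fun t _ => by split_ifs <;> positivity) (Finset.mem_univ (0 : Fin n))).trans' ?_
    rw [if_pos rfl]
  refine h1.trans ?_
  exact Finset.single_le_sum (f := fun j : Fin d → Fin n => ∑ t : Fin n,
      if (bpt n M b.1 (fun _ => 0) + tstep (fine n M) b.2 ((0 : Fin n) : ℕ), b.2) = (bpt n M b.1 j + tstep (fine n M) b.2 t, b.2) then 1 / (n : ℝ) ^ (d + 1) else (0 : ℝ))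
    (fun j _ => Finset.sum_nonneg fun t _ => by split_ifs <;> positivity) (Finset.mem_univ (fun _ => (0 : Fin n)))

end Pairing

/-! ## §2 Decay of the covariance entries on the chart ball -/

section Decay

variable (n : ℕ) [NeZero n] (M : Fin d → ℕ) [hM : ∀ μ, NeZero (M μ)]
variable {R₀ : Fin d → (Tor (fine n M) × Fin d → Matrix o o ℂ)} {Γ : ContourSystem d n M} {ℓ : ℕ} {a' γ κ : ℝ}

/-- **SET DECAY OF THE COVARIANCE ENTRIES ON THE CHART BALL** (any admissible rate): for unitary `R⁰` with `γ`-coercive real slice, `a′ ≥ 0`,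
contours of length `≤ ℓ`, `2 ≤ n·M_μ`, `‖A‖ < rho1`, `JchT κ < γ∕4`, and coarse bonds `b, b′` whose block stencils are `n·r`-separated in the fine
sup-distance: `‖C(e^{A}R⁰, (R⁰)⁻¹e^{−A})(b, b′)‖ ≤ ‖s‖·(3 + E)²·|o|·n^{−d}·e^{−κr}∕(γ∕4 − JchT)`, `E = Etr (‖A‖e^{‖A‖}) ℓ`. [folklore] -/
theorem unitCovT_chart_setDecay (hR₀ : ∀ ν i, R₀ ν i ∈ Matrix.unitaryGroup o ℂ) (hΓ : ∀ y j μ (t : Fin n), (Γ y j μ t).length ≤ ℓ)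
    (ha' : 0 ≤ a') (hco : Coercive γ (vecOp n M a' Γ R₀)) (hγ : 0 < γ) (h2 : ∀ μ, 2 ≤ fine n M μ)
    {A : Fin d → (Tor (fine n M) × Fin d → Matrix o o ℂ)} (hA : ‖A‖ < rho1 n d a' (Fintype.card o) ℓ γ)
    (hκ : 0 ≤ κ) (hJ : JchT (Fintype.card o) d n ℓ a' κ ‖A‖ < γ / 4) (s : ℂ) (b b' : (Tor M × Fin d) × o) {r : ℝ}
    (hr : ∀ i i' : Tor (fine n M) × Fin d, qr n M b.1 i ≠ 0 → qr n M b'.1 i' ≠ 0 → (n : ℝ) * r ≤ ldist (fine n M) i.1 i'.1) :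
    ‖unitCovT n M ((n : ℕ) : ℂ) (a' * (n : ℝ) ^ d) s Γ (expChart R₀ A) (expChartInv R₀ A) b b'‖
      ≤ ‖s‖ * ((3 + Etr (‖A‖ * Real.exp ‖A‖) ℓ) ^ 2 * Fintype.card o * ((n : ℝ) ^ d)⁻¹)
          * (Real.exp (-(κ * r)) / (γ / 4 - JchT (Fintype.card o) d n ℓ a' κ ‖A‖)) := by
  have hn : (0 : ℝ) < (n : ℝ) ^ d := pow_pos (by exact_mod_cast Nat.pos_of_ne_zero (NeZero.ne n)) d
  obtain ⟨_, _, hQ1, hQh, hX1⟩ := chart_entry_majorants n M hR₀ hΓ A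
  set E : ℝ := Etr (‖A‖ * Real.exp ‖A‖) ℓ with hEdef
  have hE0 : 0 ≤ E := Etr_nonneg (by positivity) ℓ
  set K : ℝ := (3 + E) ^ 2 * Fintype.card o * ((n : ℝ) ^ d)⁻¹ with hKdef
  have hK0 : 0 ≤ K := by positivity
  -- the adjoint averaging at the chart point, entrywise
  have hQa : ∀ j : (Tor (fine n M) × Fin d) × o, ‖QcovA n M Γ (expChartInv R₀ A) j b'‖ ≤ (3 + E) * qr n M b'.1 j.1 := by
    intro j
    have e : QcovA n M Γ (expChartInv R₀ A) j b'
        = (QcovA n M Γ (expChartInv R₀ A) - QcovA n M Γ (adjOf R₀)) j b' + QcovA n M Γ (adjOf R₀) j b' := by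
      rw [Matrix.sub_apply, sub_add_cancel]
    rw [e]
    calc _ ≤ ‖(QcovA n M Γ (expChartInv R₀ A) - QcovA n M Γ (adjOf R₀)) j b'‖ + ‖QcovA n M Γ (adjOf R₀) j b'‖ := norm_add_le _ _
      _ ≤ E * qr n M b'.1 j.1 + 3 * qr n M b'.1 j.1 := add_le_add (hX1 j b') (hQh j b')
      _ = (3 + E) * qr n M b'.1 j.1 := by ring
  -- the two vectors of the pairing
  set u : (Tor (fine n M) × Fin d) × o → ℂ := fun i => star (Qcov n M Γ (expChart R₀ A) b i) with hudef
  set v : (Tor (fine n M) × Fin d) × o → ℂ := fun j => QcovA n M Γ (expChartInv R₀ A) j b' with hvdef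
  have hun : ∀ i, ‖u i‖ ≤ (3 + E) * qr n M b.1 i.1 := fun i => by rw [hudef, norm_star]; exact hQ1 b i
  have hvn : ∀ j, ‖v j‖ ≤ (3 + E) * qr n M b'.1 j.1 := hQa
  have hnu : nsq u ≤ K := nsq_le_of_qr_majorant n M b.1 u hun
  have hnv : nsq v ≤ K := nsq_le_of_qr_majorant n M b'.1 v hvn
  have huv : Real.sqrt (nsq u) * Real.sqrt (nsq v) ≤ K := by
    calc Real.sqrt (nsq u) * Real.sqrt (nsq v) ≤ Real.sqrt K * Real.sqrt K :=
          mul_le_mul (Real.sqrt_le_sqrt hnu) (Real.sqrt_le_sqrt hnv) (Real.sqrt_nonneg _) (Real.sqrt_nonneg _)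
      _ = K := Real.mul_self_sqrt hK0
  -- supports: `qr ≠ 0` on the stencils
  have hu0 : ∀ i, u i ≠ 0 → qr n M b.1 i.1 ≠ 0 := by
    intro i hi hq
    apply hi
    have h := hun i
    rw [hq, mul_zero] at h
    exact norm_le_zero_iff.mp h
  have hv0 : ∀ j, v j ≠ 0 → qr n M b'.1 j.1 ≠ 0 := by
    intro j hj hq
    apply hj
    have h := hvn j
    rw [hq, mul_zero] at h
    exact norm_le_zero_iff.mp h
  -- the source: the stencil sites of `b′`
  set T : Finset (Tor (fine n M)) := Finset.univ.filter fun x => qr n M b'.1 (x, b'.1.2) ≠ 0 with hTdef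
  have hTne : T.Nonempty := by
    refine ⟨bpt n M b'.1.1 (fun _ => 0) + tstep (fine n M) b'.1.2 ((0 : Fin n) : ℕ), ?_⟩
    rw [hTdef, Finset.mem_filter]
    exact ⟨Finset.mem_univ _, (qr_stencil_pos n M b'.1).ne'⟩
  have hv : ∀ j, v j ≠ 0 → j.1.1 ∈ T := by
    intro j hj
    have hq := hv0 j hj
    obtain ⟨jj, t, hj1⟩ := qr_ne_zero n M b'.1 j.1 hq
    rw [hTdef, Finset.mem_filter]
    refine ⟨Finset.mem_univ _, ?_⟩
    have e : (j.1.1, b'.1.2) = j.1 := by rw [hj1]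
    rw [e]; exact hq
  have hu : ∀ i, u i ≠ 0 → ∀ t ∈ T, (n : ℝ) * r ≤ ldist (fine n M) i.1.1 t := by
    intro i hi t ht
    rw [hTdef, Finset.mem_filter] at ht
    exact hr i.1 (t, b'.1.2) (hu0 i hi) ht.2
  have hpair := greenT_chart_setDecay n M hR₀ hΓ ha' hco hγ h2 hA T hTne hκ hJ (u := u) (v := v) hv hu
  have hden : 0 < γ / 4 - JchT (Fintype.card o) d n ℓ a' κ ‖A‖ := by linarith
  have hfac : 0 ≤ Real.exp (-(κ * r)) / (γ / 4 - JchT (Fintype.card o) d n ℓ a' κ ‖A‖) := by positivity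
  rw [unitCovT_apply_eq_pairing, norm_mul]
  calc ‖s‖ * ‖star (fun i => star (Qcov n M Γ (expChart R₀ A) b i)) ⬝ᵥ (greenT n M ((n : ℕ) : ℂ) (a' * (n : ℝ) ^ d) Γ (expChart R₀ A) (expChartInv R₀ A) *ᵥ v)‖
      ≤ ‖s‖ * (Real.exp (-(κ * r)) / (γ / 4 - JchT (Fintype.card o) d n ℓ a' κ ‖A‖) * (Real.sqrt (nsq u) * Real.sqrt (nsq v))) :=
        mul_le_mul_of_nonneg_left hpair (norm_nonneg _)
    _ ≤ ‖s‖ * (Real.exp (-(κ * r)) / (γ / 4 - JchT (Fintype.card o) d n ℓ a' κ ‖A‖) * K) :=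
        mul_le_mul_of_nonneg_left (mul_le_mul_of_nonneg_left huv hfac) (norm_nonneg _)
    _ = _ := by rw [hKdef]; ring

/-- **ENTRY DECAY OF THE COVARIANCE SPECIES AT THE EXPLICIT RATE**: with `κ_F = kappaF |o| d a′ γ` (level- and background-free),
`‖C(e^{A}R⁰, (R⁰)⁻¹e^{−A})(b, b′)‖ ≤ ‖s‖·(3 + E)²·|o|·n^{−d}·(8∕γ)·e^{−κ_F·r}` for `n·r`-separated stencils (`E = Etr (‖A‖e^{‖A‖}) ℓ ≤ 2` inside `rho1`,
left symbolic). [folklore] -/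
theorem unitCovT_chart_entry_decay_explicit (hR₀ : ∀ ν i, R₀ ν i ∈ Matrix.unitaryGroup o ℂ) (hΓ : ∀ y j μ (t : Fin n), (Γ y j μ t).length ≤ ℓ)
    (ha' : 0 ≤ a') (hco : Coercive γ (vecOp n M a' Γ R₀)) (hγ : 0 < γ) (h2 : ∀ μ, 2 ≤ fine n M μ)
    {A : Fin d → (Tor (fine n M) × Fin d → Matrix o o ℂ)} (hA : ‖A‖ < rho1 n d a' (Fintype.card o) ℓ γ) (s : ℂ) (b b' : (Tor M × Fin d) × o)
    {r : ℝ} (hr : ∀ i i' : Tor (fine n M) × Fin d, qr n M b.1 i ≠ 0 → qr n M b'.1 i' ≠ 0 → (n : ℝ) * r ≤ ldist (fine n M) i.1 i'.1) :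
    ‖unitCovT n M ((n : ℕ) : ℂ) (a' * (n : ℝ) ^ d) s Γ (expChart R₀ A) (expChartInv R₀ A) b b'‖
      ≤ ‖s‖ * ((3 + Etr (‖A‖ * Real.exp ‖A‖) ℓ) ^ 2 * Fintype.card o * ((n : ℝ) ^ d)⁻¹)
          * (8 / γ * Real.exp (-(kappaF (Fintype.card o) d a' γ * r))) := by
  have hn1 : 1 ≤ n := Nat.one_le_iff_ne_zero.mpr (NeZero.ne n)
  have hk := kappaF_pos_le_one (Fintype.card o) d ha' hγ
  have hJ := Jch_kappaF_le ha' hγ (Fintype.card_pos (α := o)) hn1 d ℓ (norm_nonneg A) hA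
  have hJ' : JchT (Fintype.card o) d n ℓ a' (kappaF (Fintype.card o) d a' γ) ‖A‖ < γ / 4 := by linarith
  refine (unitCovT_chart_setDecay n M hR₀ hΓ ha' hco hγ h2 hA hk.1.le hJ' s b b' hr).trans ?_
  have hE0 : 0 ≤ Etr (‖A‖ * Real.exp ‖A‖) ℓ := Etr_nonneg (by positivity) ℓ
  refine mul_le_mul_of_nonneg_left ?_ (by positivity)
  have hle : (γ / 4 - JchT (Fintype.card o) d n ℓ a' (kappaF (Fintype.card o) d a' γ) ‖A‖)⁻¹ ≤ 8 / γ := by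
    rw [show (8 : ℝ) / γ = (γ / 8)⁻¹ by rw [inv_div]]
    exact inv_anti₀ (by positivity) (by linarith)
  rw [div_eq_mul_inv, mul_comm]
  exact mul_le_mul_of_nonneg_right hle (Real.exp_pos _).le

end Decay

/-! ## §3 The tower corollary on the scaling-form ball -/

section Tower

open Literature.MathematicalPhysics.QuantumFieldTheory.Balaban1983to89 (Params)
open Summit.QuantumFields.BalabanUV.T4Continuum.SubstrateBackgroundTransporters (unitMod)
open Literature.MathematicalPhysics.QuantumFieldTheory.Balaban1983to89.B5G183RateUnitTower (lev lev_neZero)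
open Summit.QuantumFields.BalabanUV.T4Continuum.SubstrateTransporterSpeciesHolo (expChartT expChartInvT)

/-- **COVARIANCE ENTRY DECAY ON THE LEVEL-`k` CYLINDER** (the cylinder form `‖A k‖ < rhoStar∕lev k` — p1's `levelBall P k (rhoStar∕lev k)`
unfolded, no condition at the other levels): at NE2 level `k` (printed letters `c = lev k`, `a = a′(lev k)^d`), unitary reference field, `γ`-coercive
real slice, contours of length `≤ ℓ ≤ (d+1)·lev k`, for coarse bonds with `lev k·r`-separated stencils,
`‖C_k(b, b′)‖ ≤ ‖s‖·(3 + E)²·|o|·(lev k)^{−d}·(8∕γ)·e^{−κ_F·r}`. [folklore] -/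
theorem unitCovT_chart_entry_decay_level (P : Params) (Γ : (k : ℕ) → ContourSystem P.d (lev P.L k) (unitMod P)) {R₀ : TowerData P o}
    (k : Fin (P.K + 1)) {ℓ : ℕ} (hΓ : ∀ y j μ (t : Fin (lev P.L k)), (Γ k y j μ t).length ≤ ℓ) (hℓ : (ℓ : ℝ) ≤ ((P.d : ℝ) + 1) * (lev P.L k : ℕ))
    (hR₀ : ∀ ν i, R₀ k ν i ∈ Matrix.unitaryGroup o ℂ) {a' γ : ℝ} (ha' : 0 ≤ a') (hco : Coercive γ (vecOp (lev P.L k) (unitMod P) a' (Γ k) (R₀ k)))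
    (hγ : 0 < γ) (h2 : ∀ μ, 2 ≤ fine (lev P.L k) (unitMod P) μ) {A : TowerData P o}
    (hA : ‖A k‖ < rhoStar γ P.d a' (Fintype.card o) / (lev P.L k : ℕ)) (s : ℂ) (b b' : (Tor (unitMod P) × Fin P.d) × o) {r : ℝ}
    (hr : ∀ i i' : Tor (fine (lev P.L k) (unitMod P)) × Fin P.d, qr (lev P.L k) (unitMod P) b.1 i ≠ 0 → qr (lev P.L k) (unitMod P) b'.1 i' ≠ 0 →
      ((lev P.L k : ℕ) : ℝ) * r ≤ ldist (fine (lev P.L k) (unitMod P)) i.1 i'.1) :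
    ‖unitCovT (lev P.L k) (unitMod P) (((lev P.L k : ℕ) : ℂ)) (a' * ((lev P.L k : ℕ) : ℝ) ^ P.d) s (Γ k) (expChartT P R₀ A k) (expChartInvT P R₀ A k) b b'‖
      ≤ ‖s‖ * ((3 + Etr (‖A k‖ * Real.exp ‖A k‖) ℓ) ^ 2 * Fintype.card o * (((lev P.L k : ℕ) : ℝ) ^ P.d)⁻¹)
          * (8 / γ * Real.exp (-(kappaF (Fintype.card o) P.d a' γ * r))) := by
  have hn : 1 ≤ (lev P.L k : ℕ) := Nat.one_le_iff_ne_zero.mpr (NeZero.ne _)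
  have hAk : ‖A k‖ < rho1 (lev P.L k) P.d a' (Fintype.card o) ℓ γ :=
    lt_of_lt_of_le hA (rhoStar_div_le_rho1 (lev P.L k) (d := P.d) ha' hγ (Fintype.card o) hn hℓ)
  exact unitCovT_chart_entry_decay_explicit (lev P.L k) (unitMod P) hR₀ hΓ ha' hco hγ h2 hAk s b b' hr

/-- **COVARIANCE ENTRY DECAY ON THE TOWER BALL OF RECORD** `InHoloBallT P R⁰ (rhoStar∕lev k)` (`inHoloBallT_apply` ⇒ the cylinder form). [folklore] -/
theorem unitCovT_chart_entry_decay_tower (P : Params) (Γ : (k : ℕ) → ContourSystem P.d (lev P.L k) (unitMod P)) {R₀ : TowerData P o}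
    (k : Fin (P.K + 1)) {ℓ : ℕ} (hΓ : ∀ y j μ (t : Fin (lev P.L k)), (Γ k y j μ t).length ≤ ℓ) (hℓ : (ℓ : ℝ) ≤ ((P.d : ℝ) + 1) * (lev P.L k : ℕ))
    (hR₀ : ∀ ν i, R₀ k ν i ∈ Matrix.unitaryGroup o ℂ) {a' γ : ℝ} (ha' : 0 ≤ a') (hco : Coercive γ (vecOp (lev P.L k) (unitMod P) a' (Γ k) (R₀ k)))
    (hγ : 0 < γ) (h2 : ∀ μ, 2 ≤ fine (lev P.L k) (unitMod P) μ) {A : TowerData P o}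
    (hA : InHoloBallT P R₀ (rhoStar γ P.d a' (Fintype.card o) / (lev P.L k : ℕ)) A) (s : ℂ) (b b' : (Tor (unitMod P) × Fin P.d) × o) {r : ℝ}
    (hr : ∀ i i' : Tor (fine (lev P.L k) (unitMod P)) × Fin P.d, qr (lev P.L k) (unitMod P) b.1 i ≠ 0 → qr (lev P.L k) (unitMod P) b'.1 i' ≠ 0 →
      ((lev P.L k : ℕ) : ℝ) * r ≤ ldist (fine (lev P.L k) (unitMod P)) i.1 i'.1) :
    ‖unitCovT (lev P.L k) (unitMod P) (((lev P.L k : ℕ) : ℂ)) (a' * ((lev P.L k : ℕ) : ℝ) ^ P.d) s (Γ k) (expChartT P R₀ A k) (expChartInvT P R₀ A k) b b'‖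
      ≤ ‖s‖ * ((3 + Etr (‖A k‖ * Real.exp ‖A k‖) ℓ) ^ 2 * Fintype.card o * (((lev P.L k : ℕ) : ℝ) ^ P.d)⁻¹)
          * (8 / γ * Real.exp (-(kappaF (Fintype.card o) P.d a' γ * r))) :=
  unitCovT_chart_entry_decay_level P Γ k hΓ hℓ hR₀ ha' hco hγ h2 (inHoloBallT_apply P hA k) s b b' hr

end Tower

/-! ## §4 The level shape: `(3 + E)² ≤ 16` on the cylinder `levelBall P k (rhoStar∕lev k)` (ruling (λ15)) -/

section LevelShape

open Literature.MathematicalPhysics.QuantumFieldTheory.Balaban1983to89 (Params)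
open Summit.QuantumFields.BalabanUV.T4Continuum.SubstrateBackgroundTransporters (unitMod)
open Literature.MathematicalPhysics.QuantumFieldTheory.Balaban1983to89.B5G183RateUnitTower (lev lev_neZero)
open Summit.QuantumFields.BalabanUV.T4Continuum.SubstrateTransporterSpeciesHolo (expChartT expChartInvT)
open Summit.QuantumFields.BalabanUV.T4Continuum.SubstrateTransporterSpeciesLev (cPr aPr covAtTLev)
open Summit.QuantumFields.BalabanUV.T4Continuum.SubstrateTransporterSpeciesLevExplicit (levelBall)
open Summit.QuantumFields.BalabanUV.T4Continuum.SubstrateCovarianceChartBound (Etr_le_one ell_mul_delta_le_half)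

variable (P : Params) (Γ : (k : ℕ) → ContourSystem P.d (lev P.L k) (unitMod P)) {R₀ : TowerData P o}

omit [Nonempty o] in
/-- **`E ≤ 1` ON THE CYLINDER**: for `‖A k‖ < rhoStar∕lev k` and contours `ℓ ≤ (d+1)·lev k` the transport modulus `E = Etr (‖A k‖e^{‖A k‖}) ℓ` is at
most `1` — W-15's `ell_mul_delta_le_half` (`rhoStar ≤ ¼`, `≤ 1∕(3(d+1)+1)`) and `Etr_le_one`, cited BY NAME. [folklore] -/
theorem Etr_le_one_of_lt_rhoStar_div (k : Fin (P.K + 1)) {ℓ : ℕ} (hℓ : (ℓ : ℝ) ≤ ((P.d : ℝ) + 1) * (lev P.L k : ℕ)) {a' γ : ℝ}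
    {A : TowerData P o} (hA : ‖A k‖ < rhoStar γ P.d a' (Fintype.card o) / (lev P.L k : ℕ)) :
    Etr (‖A k‖ * Real.exp ‖A k‖) ℓ ≤ 1 := by
  have hlev : 1 ≤ lev P.L k := Nat.pos_of_ne_zero (NeZero.ne _)
  refine Etr_le_one (by positivity) (ell_mul_delta_le_half (lev P.L k) (d := P.d) hlev (norm_nonneg _) hA.le ?_ ?_ hℓ)
  · unfold rhoStar; exact (min_le_left _ _).trans (min_le_left _ _)
  · unfold rhoStar; exact (min_le_left _ _).trans (min_le_right _ _)

omit [Nonempty o] in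
/-- the squared averaging prefactor on the cylinder: `(3 + E)² ≤ 16`. [folklore] -/
theorem three_add_Etr_sq_le (k : Fin (P.K + 1)) {ℓ : ℕ} (hℓ : (ℓ : ℝ) ≤ ((P.d : ℝ) + 1) * (lev P.L k : ℕ)) {a' γ : ℝ}
    {A : TowerData P o} (hA : ‖A k‖ < rhoStar γ P.d a' (Fintype.card o) / (lev P.L k : ℕ)) :
    (3 + Etr (‖A k‖ * Real.exp ‖A k‖) ℓ) ^ 2 ≤ 16 := by
  have hE1 := Etr_le_one_of_lt_rhoStar_div P k hℓ hA
  have hE0 : 0 ≤ Etr (‖A k‖ * Real.exp ‖A k‖) ℓ := Etr_nonneg (by positivity) ℓ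
  nlinarith

/-- **COVARIANCE ENTRY DECAY ON THE CYLINDER, LEVEL SHAPE** (p1's `levelBall P k (rhoStar∕lev k)` — no condition at the other levels; the printed
letters `cPr P k = lev k`, `aPr P a′ k = a′(lev k)^d`): `‖C_k(b, b′)‖ ≤ ‖s‖·(16·|o|·((lev k)^d)⁻¹)·(8∕γ)·e^{−κ_F·r}` for `lev k·r`-separated
stencils — rate `κ_F = kappaF |o| d a′ γ` and separation `r` LEVEL-FREE, amplitude level-indexed only through `(lev k)^{−d}`. [folklore] -/
theorem unitCovT_chart_entry_decay_levelBall (k : Fin (P.K + 1)) {ℓ : ℕ} (hΓ : ∀ y j μ (t : Fin (lev P.L k)), (Γ k y j μ t).length ≤ ℓ)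
    (hℓ : (ℓ : ℝ) ≤ ((P.d : ℝ) + 1) * (lev P.L k : ℕ)) (hR₀ : ∀ ν i, R₀ k ν i ∈ Matrix.unitaryGroup o ℂ) {a' γ : ℝ} (ha' : 0 ≤ a')
    (hco : Coercive γ (vecOp (lev P.L k) (unitMod P) a' (Γ k) (R₀ k))) (hγ : 0 < γ) (h2 : ∀ μ, 2 ≤ fine (lev P.L k) (unitMod P) μ)
    {A : TowerData P o} (hA : A ∈ levelBall P k (rhoStar γ P.d a' (Fintype.card o) / (lev P.L k : ℕ))) (s : ℂ)
    (b b' : (Tor (unitMod P) × Fin P.d) × o) {r : ℝ}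
    (hr : ∀ i i' : Tor (fine (lev P.L k) (unitMod P)) × Fin P.d, qr (lev P.L k) (unitMod P) b.1 i ≠ 0 → qr (lev P.L k) (unitMod P) b'.1 i' ≠ 0 →
      ((lev P.L k : ℕ) : ℝ) * r ≤ ldist (fine (lev P.L k) (unitMod P)) i.1 i'.1) :
    ‖unitCovT (lev P.L k) (unitMod P) (cPr P k) (aPr P a' k) s (Γ k) (expChartT P R₀ A k) (expChartInvT P R₀ A k) b b'‖
      ≤ ‖s‖ * (16 * Fintype.card o * (((lev P.L k : ℕ) : ℝ) ^ P.d)⁻¹) * (8 / γ * Real.exp (-(kappaF (Fintype.card o) P.d a' γ * r))) := by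
  have hA' : ‖A k‖ < rhoStar γ P.d a' (Fintype.card o) / (lev P.L k : ℕ) := hA
  refine (unitCovT_chart_entry_decay_level P Γ k hΓ hℓ hR₀ ha' hco hγ h2 hA' s b b' hr).trans ?_
  have h16 := three_add_Etr_sq_le P k hℓ hA'
  have hpos : 0 ≤ 8 / γ * Real.exp (-(kappaF (Fintype.card o) P.d a' γ * r)) := by positivity
  refine mul_le_mul_of_nonneg_right (mul_le_mul_of_nonneg_left ?_ (norm_nonneg _)) hpos
  exact mul_le_mul_of_nonneg_right (mul_le_mul_of_nonneg_right h16 (Nat.cast_nonneg _)) (by positivity)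

/-- **… ON THE TOWER BALL OF RECORD, LEVEL SHAPE** (ruling (λ15), the name it asks for): on `InHoloBallT P R⁰ (rhoStar∕lev k)`,
`‖C_k(b, b′)‖ ≤ ‖s‖·(16·|o|·((lev k)^d)⁻¹)·(8∕γ)·e^{−κ_F·r}`. [folklore] -/
theorem unitCovT_chart_entry_decay_tower_levelShape (k : Fin (P.K + 1)) {ℓ : ℕ} (hΓ : ∀ y j μ (t : Fin (lev P.L k)), (Γ k y j μ t).length ≤ ℓ)
    (hℓ : (ℓ : ℝ) ≤ ((P.d : ℝ) + 1) * (lev P.L k : ℕ)) (hR₀ : ∀ ν i, R₀ k ν i ∈ Matrix.unitaryGroup o ℂ) {a' γ : ℝ} (ha' : 0 ≤ a')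
    (hco : Coercive γ (vecOp (lev P.L k) (unitMod P) a' (Γ k) (R₀ k))) (hγ : 0 < γ) (h2 : ∀ μ, 2 ≤ fine (lev P.L k) (unitMod P) μ)
    {A : TowerData P o} (hA : InHoloBallT P R₀ (rhoStar γ P.d a' (Fintype.card o) / (lev P.L k : ℕ)) A) (s : ℂ)
    (b b' : (Tor (unitMod P) × Fin P.d) × o) {r : ℝ}
    (hr : ∀ i i' : Tor (fine (lev P.L k) (unitMod P)) × Fin P.d, qr (lev P.L k) (unitMod P) b.1 i ≠ 0 → qr (lev P.L k) (unitMod P) b'.1 i' ≠ 0 →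
      ((lev P.L k : ℕ) : ℝ) * r ≤ ldist (fine (lev P.L k) (unitMod P)) i.1 i'.1) :
    ‖unitCovT (lev P.L k) (unitMod P) (cPr P k) (aPr P a' k) s (Γ k) (expChartT P R₀ A k) (expChartInvT P R₀ A k) b b'‖
      ≤ ‖s‖ * (16 * Fintype.card o * (((lev P.L k : ℕ) : ℝ) ^ P.d)⁻¹) * (8 / γ * Real.exp (-(kappaF (Fintype.card o) P.d a' γ * r))) :=
  unitCovT_chart_entry_decay_levelBall P Γ k hΓ hℓ hR₀ ha' hco hγ h2 (inHoloBallT_apply P hA k) s b b' hr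

/-- **… LEVEL-FREE AMPLITUDE** for one weight `s` (`(lev k)^{−d} ≤ 1` dropped): `‖C_k(b, b′)‖ ≤ ‖s‖·(16·|o|)·(8∕γ)·e^{−κ_F·r}` — NO letter on the
right sees `k`.  (For a weight SEQUENCE `s k` the one level-indexed letter left is `‖s k‖`; a bounded sequence gives the consumer's `sup`.) [folklore] -/
theorem unitCovT_chart_entry_decay_tower_levelFree (k : Fin (P.K + 1)) {ℓ : ℕ} (hΓ : ∀ y j μ (t : Fin (lev P.L k)), (Γ k y j μ t).length ≤ ℓ)
    (hℓ : (ℓ : ℝ) ≤ ((P.d : ℝ) + 1) * (lev P.L k : ℕ)) (hR₀ : ∀ ν i, R₀ k ν i ∈ Matrix.unitaryGroup o ℂ) {a' γ : ℝ} (ha' : 0 ≤ a')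
    (hco : Coercive γ (vecOp (lev P.L k) (unitMod P) a' (Γ k) (R₀ k))) (hγ : 0 < γ) (h2 : ∀ μ, 2 ≤ fine (lev P.L k) (unitMod P) μ)
    {A : TowerData P o} (hA : InHoloBallT P R₀ (rhoStar γ P.d a' (Fintype.card o) / (lev P.L k : ℕ)) A) (s : ℂ)
    (b b' : (Tor (unitMod P) × Fin P.d) × o) {r : ℝ}
    (hr : ∀ i i' : Tor (fine (lev P.L k) (unitMod P)) × Fin P.d, qr (lev P.L k) (unitMod P) b.1 i ≠ 0 → qr (lev P.L k) (unitMod P) b'.1 i' ≠ 0 →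
      ((lev P.L k : ℕ) : ℝ) * r ≤ ldist (fine (lev P.L k) (unitMod P)) i.1 i'.1) :
    ‖unitCovT (lev P.L k) (unitMod P) (cPr P k) (aPr P a' k) s (Γ k) (expChartT P R₀ A k) (expChartInvT P R₀ A k) b b'‖
      ≤ ‖s‖ * (16 * Fintype.card o) * (8 / γ * Real.exp (-(kappaF (Fintype.card o) P.d a' γ * r))) := by
  refine (unitCovT_chart_entry_decay_tower_levelShape P Γ k hΓ hℓ hR₀ ha' hco hγ h2 hA s b b' hr).trans ?_
  have h1 : (1 : ℝ) ≤ ((lev P.L k : ℕ) : ℝ) ^ P.d := one_le_pow₀ (by exact_mod_cast Nat.pos_of_ne_zero (NeZero.ne _))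
  have hpos : 0 ≤ 8 / γ * Real.exp (-(kappaF (Fintype.card o) P.d a' γ * r)) := by positivity
  refine mul_le_mul_of_nonneg_right (mul_le_mul_of_nonneg_left ?_ (norm_nonneg _)) hpos
  have h16 : (0 : ℝ) ≤ 16 * Fintype.card o := by positivity
  calc 16 * (Fintype.card o : ℝ) * (((lev P.L k : ℕ) : ℝ) ^ P.d)⁻¹ ≤ 16 * Fintype.card o * 1 :=
        mul_le_mul_of_nonneg_left (inv_le_one_of_one_le₀ h1) h16
    _ = 16 * Fintype.card o := mul_one _

/-- **THE `covAtTLev` ENTRY FACE ON THE CYLINDER** (W-15's `norm_covAtTLev_le_on_levelBall` with decay — weights `s : ℕ → ℂ`, printed letter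
families `cPr P`, `aPr P a′`, any tag `t`, level `k ≤ K`): `‖covAtTLev … k t b b′‖ ≤ ‖s k‖·(16·|o|·((lev k)^d)⁻¹)·(8∕γ)·e^{−κ_F·r}`. [folklore] -/
theorem norm_covAtTLev_chart_entry_decay_on_levelBall (s : ℕ → ℂ) (k : Fin (P.K + 1)) {ℓ : ℕ}
    (hΓ : ∀ y j μ (t : Fin (lev P.L k)), (Γ k y j μ t).length ≤ ℓ) (hℓ : (ℓ : ℝ) ≤ ((P.d : ℝ) + 1) * (lev P.L k : ℕ))
    (hR₀ : ∀ ν i, R₀ k ν i ∈ Matrix.unitaryGroup o ℂ) {a' γ : ℝ} (ha' : 0 ≤ a') (hco : Coercive γ (vecOp (lev P.L k) (unitMod P) a' (Γ k) (R₀ k)))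
    (hγ : 0 < γ) (h2 : ∀ μ, 2 ≤ fine (lev P.L k) (unitMod P) μ) {A : TowerData P o}
    (hA : A ∈ levelBall P k (rhoStar γ P.d a' (Fintype.card o) / (lev P.L k : ℕ))) {T : Type*} (t : T)
    (b b' : (Tor (unitMod P) × Fin P.d) × o) {r : ℝ}
    (hr : ∀ i i' : Tor (fine (lev P.L k) (unitMod P)) × Fin P.d, qr (lev P.L k) (unitMod P) b.1 i ≠ 0 → qr (lev P.L k) (unitMod P) b'.1 i' ≠ 0 →
      ((lev P.L k : ℕ) : ℝ) * r ≤ ldist (fine (lev P.L k) (unitMod P)) i.1 i'.1) :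
    ‖covAtTLev P (cPr P) (aPr P a') Γ s (expChartT P R₀ A) (expChartInvT P R₀ A) k t b b'‖
      ≤ ‖s k‖ * (16 * Fintype.card o * (((lev P.L k : ℕ) : ℝ) ^ P.d)⁻¹) * (8 / γ * Real.exp (-(kappaF (Fintype.card o) P.d a' γ * r))) := by
  unfold covAtTLev covAtT
  simp only [dif_pos (Nat.le_of_lt_succ k.2), Fin.eta]
  exact unitCovT_chart_entry_decay_levelBall P Γ k hΓ hℓ hR₀ ha' hco hγ h2 hA (s k) b b' hr

end LevelShape

end Summit.QuantumFields.BalabanUV.T4Continuum.CovariantVectorCovarianceDecayChart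

end
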